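import Summits.ValiantsHypothesis.ValiantsHypothesis.Theorems.LacunarySymmetroidMatrixDescartesCensusKit

/-!
# `MatrixDescartes` census — REFLECTIVE certificate kit: `¬ PosRootLawAt m K B` by one kernel computation

HONEST FRAMING.  Bookkeeping / verification infrastructure for the finite census of real symmetric lacunary pencils
(cells `pub-symmetroid`, `val-V1-extremal`).  Nothing here bears on the asymptotic crux
`Theses.LacunarySymmetroid.MatrixDescartes` (stmt-ValiantsHypothesis-18050) nor on `VP ≠ VNP`.

WHAT IT DOES.  The existing kit (`…CensusKit :: not_posRootLawAt_of_certificate`) needs the CLOSED FORM of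
`det (∑ l, t ^ d l • S l)` as a polynomial literal (proved by `simp` + `ring`) and one `norm_num` sign evaluation per
test point; for graft / flag / tower rows (entries of several hundred to a few thousand digits, degree in the
thousands, `m = 5, 6`) the closed form alone exceeds the gate's file size and `ring` time (typer README, v7.1 limits).
Here the determinant is NEVER expanded: for an INTEGER pencil and positive rational test points `a_j / b_j` the file's
only obligation is `certCheck m K N d S a b = true`, a closed Boolean term that the kernel evaluates (`decide +kernel`;
GMP-backed `Nat`/`Int` arithmetic), where `certCheck` (i) checks every `S l` symmetric, (ii) checks
`0 < a_j`, `0 < b_j` and `a_j/b_j` strictly increasing, (iii) computes `sign det (b_j^D • F(a_j/b_j))` EXACTLY as the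
integer Laplace determinant `idet` of the integer matrix `∑ l, a_j^{d l} b_j^{D − d l} S l` (`D = max d`) and checks that
consecutive signs multiply to `−1`.  `not_posRootLawAt_of_certCheck` turns `certCheck … = true` into
`¬ PosRootLawAt m K B` for every `B < N` (via `Census.not_posRootLawAt_of_certificate`, i.e. the intermediate value
theorem `le_card_posRoots_of_alternating`).  Soundness is proved once, here: `idet = Matrix.det` (Laplace along row 0,
`Matrix.det_succ_row_zero`), `finSum = ∑`, and `(b^D)^m · det F(a/b) = det (∑ l, a^{d l} b^{D−d l} S l)` (`Matrix.det_smul`).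

[folklore] Elementary (Laplace expansion, intermediate value theorem); proof by reflection.
-/

-- `Summit.ValiantsHypothesis.ValiantsHypothesis.…` repeats a component by the D-0017 layout
-- (single-conjunct summit), which the `dupNamespace` linter flags; the name is mandated.
set_option linter.dupNamespace false

namespace Summit.ValiantsHypothesis.ValiantsHypothesis.Theorems.LacunarySymmetroidMatrixDescartes.Census.Reflect

open Summit.ValiantsHypothesis.ValiantsHypothesis.Theorems.MatrixDescartes.Negative (PosRootLawAt)
open Summit.ValiantsHypothesis.ValiantsHypothesis.Theorems.LacunarySymmetroidMatrixDescartes.Census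
  (not_posRootLawAt_of_certificate)
open scoped BigOperators Matrix

/-! ### Kernel-reducible primitives -/

/-- Structural sum over `Fin K` (kernel-reducible replacement for `∑`). [folklore] -/
def finSum : (K : ℕ) → (Fin K → ℤ) → ℤ
  | 0, _ => 0
  | K + 1, f => f 0 + finSum K (fun l => f l.succ)

/-- Structural Boolean `∀` over `Fin K`. [folklore] -/
def finAll : (K : ℕ) → (Fin K → Bool) → Bool
  | 0, _ => true
  | K + 1, p => p 0 && finAll K (fun l => p l.succ)

/-- Structural maximum over `Fin K` of naturals (`0` on `Fin 0`). [folklore] -/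
def finMax : (K : ℕ) → (Fin K → ℕ) → ℕ
  | 0, _ => 0
  | K + 1, f => max (f 0) (finMax K (fun l => f l.succ))

/-- Integer Laplace determinant, expansion along row `0` (kernel-reducible replacement for `Matrix.det`). [folklore] -/
def idet : (n : ℕ) → (Fin n → Fin n → ℤ) → ℤ
  | 0, _ => 1
  | n + 1, M => finSum (n + 1) (fun j =>
      (if (j : ℕ) % 2 = 0 then M 0 j else -M 0 j) * idet n (fun i k => M i.succ (j.succAbove k)))

/-- The integer matrix `b^D • F(a/b) = ∑ l, a^{d l} b^{D − d l} S l` of an integer pencil at the rational point `a/b`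
(`D ≥ d l` for all `l`). [folklore] -/
def evalAt (m K D : ℕ) (d : Fin K → ℕ) (S : Fin K → Fin m → Fin m → ℤ) (a b : ℕ) :
    Fin m → Fin m → ℤ :=
  fun i j => finSum K (fun l => ((a ^ d l * b ^ (D - d l) : ℕ) : ℤ) * S l i j)

/-- Exact sign (`−1, 0, 1`) of `det F(a/b)` for an integer pencil, computed in `ℤ`. [folklore] -/
def signAt (m K D : ℕ) (d : Fin K → ℕ) (S : Fin K → Fin m → Fin m → ℤ) (a b : ℕ) : ℤ :=
  Int.sign (idet m (evalAt m K D d S a b))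

/-- **The certificate check** for an integer pencil `F = ∑ l, X^{d l} • S l` (`S l` integer `m × m`, `K` letters) and
`N + 1` rational test points `a j / b j`: all `S l` symmetric; `0 < a j`, `0 < b j`; points strictly increasing;
consecutive exact determinant signs multiply to `−1`. [folklore] -/
def certCheck (m K N : ℕ) (d : Fin K → ℕ) (S : Fin K → Fin m → Fin m → ℤ) (a b : Fin (N + 1) → ℕ) : Bool :=
  finAll K (fun l => finAll m (fun i => finAll m (fun j => S l i j == S l j i)))
  && (finAll (N + 1) (fun j => decide (0 < a j) && decide (0 < b j))
  && (finAll N (fun i => decide (a i.castSucc * b i.succ < a i.succ * b i.castSucc))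
  && finAll N (fun i => signAt m K (finMax K d) d S (a i.castSucc) (b i.castSucc)
        * signAt m K (finMax K d) d S (a i.succ) (b i.succ) == -1)))

/-! ### Soundness of the primitives -/

/-- `finSum` is the `Finset` sum. [folklore] -/
theorem finSum_eq (K : ℕ) (f : Fin K → ℤ) : finSum K f = ∑ l, f l := by
  induction K with
  | zero => simp [finSum]
  | succ K ih => rw [finSum, ih, Fin.sum_univ_succ]

/-- `finAll p = true` gives `p l` for every `l`. [folklore] -/
theorem of_finAll {K : ℕ} {p : Fin K → Bool} (h : finAll K p = true) (l : Fin K) : p l = true := by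
  induction K with
  | zero => exact l.elim0
  | succ K ih =>
    simp only [finAll, Bool.and_eq_true] at h
    cases l using Fin.cases with
    | zero => exact h.1
    | succ i => exact ih h.2 i

/-- every value is below `finMax`. [folklore] -/
theorem le_finMax {K : ℕ} (f : Fin K → ℕ) (l : Fin K) : f l ≤ finMax K f := by
  induction K with
  | zero => exact l.elim0
  | succ K ih =>
    cases l using Fin.cases with
    | zero => exact le_max_left _ _
    | succ i => exact (ih (fun l => f l.succ) i).trans (le_max_right _ _)

/-- `idet` is the determinant (Laplace expansion along row `0`, `Matrix.det_succ_row_zero`). [folklore] -/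
theorem idet_eq (n : ℕ) (M : Fin n → Fin n → ℤ) : idet n M = (Matrix.of M).det := by
  induction n with
  | zero => simp [idet, Matrix.det_fin_zero]
  | succ n ih =>
    rw [idet, finSum_eq, Matrix.det_succ_row_zero]
    refine Finset.sum_congr rfl (fun j _ => ?_)
    rw [ih]
    have hsub : (Matrix.of M).submatrix Fin.succ j.succAbove
        = Matrix.of (fun i k => M i.succ (j.succAbove k)) := rfl
    rw [hsub, Matrix.of_apply]
    rcases Nat.even_or_odd (j : ℕ) with hj | hj
    · rw [if_pos (Nat.even_iff.mp hj), hj.neg_one_pow, one_mul]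
    · rw [if_neg (by rw [Nat.odd_iff.mp hj]; decide), hj.neg_one_pow, neg_one_mul]

/-- The real pencil of an integer letter family. [folklore] -/
theorem realLetters_isSymm {m K : ℕ} {S : Fin K → Fin m → Fin m → ℤ}
    (h : ∀ l i j, S l i j = S l j i) (l : Fin K) :
    (Matrix.of fun i j => (S l i j : ℝ)).IsSymm := by
  ext i j
  simp [Matrix.transpose_apply, Matrix.of_apply, h l i j]

/-- **Evaluation lemma**: `(b^D)^m · det F(a/b) = (idet (evalAt …) : ℝ)` for `b ≠ 0` and `D ≥ d l`. [folklore] -/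
theorem det_evalAt {m K D : ℕ} (d : Fin K → ℕ) (hD : ∀ l, d l ≤ D) (S : Fin K → Fin m → Fin m → ℤ)
    (a b : ℕ) (hb : (b : ℝ) ≠ 0) :
    ((b : ℝ) ^ D) ^ m * (∑ l, ((a : ℝ) / b) ^ d l • (Matrix.of fun i j => (S l i j : ℝ))).det
      = (idet m (evalAt m K D d S a b) : ℝ) := by
  rw [idet_eq, Int.cast_det]
  have hsm := Matrix.det_smul (∑ l, ((a : ℝ) / b) ^ d l • (Matrix.of fun i j => (S l i j : ℝ))) ((b : ℝ) ^ D)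
  rw [Fintype.card_fin] at hsm
  rw [← hsm, Finset.smul_sum]
  congr 1
  ext i j
  simp only [Matrix.smul_apply, Matrix.sum_apply, Matrix.of_apply, Matrix.map_apply, evalAt, finSum_eq,
    Int.cast_sum, Int.cast_mul, Nat.cast_mul, Nat.cast_pow, smul_eq_mul]
  refine Finset.sum_congr rfl (fun l _ => ?_)
  have hsplit : (b : ℝ) ^ D = (b : ℝ) ^ (D - d l) * (b : ℝ) ^ d l := by
    rw [← pow_add, Nat.sub_add_cancel (hD l)]
  rw [div_pow, hsplit]
  field_simp
  push_cast
  ring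

/-- sign bookkeeping: if the integer signs of `x` and `y` multiply to `−1` then `x · y < 0` in `ℝ` after any common
positive rescaling. [folklore] -/
theorem mul_neg_of_sign {x y : ℤ} (h : Int.sign x * Int.sign y = -1) : (x : ℝ) * (y : ℝ) < 0 := by
  rw [← Int.sign_mul, Int.sign_eq_neg_one_iff_neg] at h
  exact_mod_cast h

/-! ### The soundness theorem -/

/-- **Reflective certificate ⇒ row.**  If `certCheck m K N d S a b = true` (one kernel computation) then the real symmetric
pencil `∑ l, X^{d l} • S l` has `N + 1` positive points with strictly alternating determinant signs, hence at least `N`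
distinct positive determinant roots, hence `¬ PosRootLawAt m K B` for every `B < N`. [folklore] -/
theorem not_posRootLawAt_of_certCheck {m K N B : ℕ} {d : Fin K → ℕ} {S : Fin K → Fin m → Fin m → ℤ}
    {a b : Fin (N + 1) → ℕ} (h : certCheck m K N d S a b = true) (hB : B < N) :
    ¬ PosRootLawAt m K B := by
  simp only [certCheck, Bool.and_eq_true] at h
  obtain ⟨hsymm, hpos, hmono, hsign⟩ := h
  have hS : ∀ l i j, S l i j = S l j i := fun l i j => by
    simpa using of_finAll (of_finAll (of_finAll hsymm l) i) j
  have ha : ∀ j, 0 < a j := fun j => by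
    have := of_finAll hpos j; simp only [Bool.and_eq_true, decide_eq_true_eq] at this; exact this.1
  have hb : ∀ j, 0 < b j := fun j => by
    have := of_finAll hpos j; simp only [Bool.and_eq_true, decide_eq_true_eq] at this; exact this.2
  have hlt : ∀ i : Fin N, a i.castSucc * b i.succ < a i.succ * b i.castSucc := fun i => by
    simpa using of_finAll hmono i
  have hsg : ∀ i : Fin N, signAt m K (finMax K d) d S (a i.castSucc) (b i.castSucc)
      * signAt m K (finMax K d) d S (a i.succ) (b i.succ) = -1 := fun i => by
    simpa using of_finAll hsign i
  -- the real pencil and its test points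
  set SR : Fin K → Matrix (Fin m) (Fin m) ℝ := fun l => Matrix.of fun i j => (S l i j : ℝ) with hSR
  let τ : Fin (N + 1) → ℝ := fun j => (a j : ℝ) / (b j : ℝ)
  have hbR : ∀ j, (0 : ℝ) < b j := fun j => by exact_mod_cast hb j
  have hτpos : ∀ j, 0 < τ j := fun j => div_pos (by exact_mod_cast ha j) (hbR j)
  have hτ : StrictMono τ := by
    refine Fin.strictMono_iff_lt_succ.mpr (fun i => ?_)
    show (a i.castSucc : ℝ) / b i.castSucc < (a i.succ : ℝ) / b i.succ
    rw [div_lt_div_iff₀ (hbR _) (hbR _)]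
    exact_mod_cast hlt i
  refine not_posRootLawAt_of_certificate (d := d) (S := SR)
    (q := fun t => (∑ l, t ^ d l • SR l).det) (fun t => rfl) (fun l => realLetters_isSymm hS l)
    τ hτ hτpos (fun i => ?_) hB
  -- alternation at consecutive points from the integer signs
  have hD : ∀ l, d l ≤ finMax K d := le_finMax d
  have key : ∀ j : Fin (N + 1),
      ((b j : ℝ) ^ finMax K d) ^ m * (∑ l, τ j ^ d l • SR l).det
        = (idet m (evalAt m K (finMax K d) d S (a j) (b j)) : ℝ) := fun j =>
    det_evalAt d hD S (a j) (b j) (ne_of_gt (hbR j))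
  have hc : ∀ j : Fin (N + 1), (0 : ℝ) < ((b j : ℝ) ^ finMax K d) ^ m := fun j =>
    pow_pos (pow_pos (hbR j) _) _
  have hneg := mul_neg_of_sign (hsg i)
  rw [← key, ← key] at hneg
  -- (c₁ q₁)(c₂ q₂) < 0 with c₁, c₂ > 0 ⇒ q₁ q₂ < 0
  have hcc : (0 : ℝ) < ((b i.castSucc : ℝ) ^ finMax K d) ^ m * ((b i.succ : ℝ) ^ finMax K d) ^ m :=
    mul_pos (hc _) (hc _)
  have hprod : ((b i.castSucc : ℝ) ^ finMax K d) ^ m * ((b i.succ : ℝ) ^ finMax K d) ^ m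
      * ((∑ l, τ i.castSucc ^ d l • SR l).det * (∑ l, τ i.succ ^ d l • SR l).det) < 0 := by
    calc ((b i.castSucc : ℝ) ^ finMax K d) ^ m * ((b i.succ : ℝ) ^ finMax K d) ^ m
          * ((∑ l, τ i.castSucc ^ d l • SR l).det * (∑ l, τ i.succ ^ d l • SR l).det)
        = (((b i.castSucc : ℝ) ^ finMax K d) ^ m * (∑ l, τ i.castSucc ^ d l • SR l).det)
          * ((((b i.succ : ℝ) ^ finMax K d) ^ m) * (∑ l, τ i.succ ^ d l • SR l).det) := by ring
      _ < 0 := hneg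
  exact lt_of_not_ge (fun hge => absurd hprod (not_lt.mpr (mul_nonneg hcc.le hge)))

/-- Convenience form with the root count read off the number of points: `N + 1` points ⇒ `¬ PosRootLawAt m K (N − 1)`
for `1 ≤ N`. [folklore] -/
theorem not_posRootLawAt_of_certCheck' {m K N : ℕ} {d : Fin K → ℕ} {S : Fin K → Fin m → Fin m → ℤ}
    {a b : Fin (N + 1) → ℕ} (h : certCheck m K N d S a b = true) (hN : 1 ≤ N) :
    ¬ PosRootLawAt m K (N - 1) :=
  not_posRootLawAt_of_certCheck h (by omega)

/-! ### Smoke test (tiny): `det (diag(−1,−2) + t·1) = (t−1)(t−2)` alternates `+,−,+` at `1/2, 3/2, 4`. -/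

/-- a 2×2 two-letter toy row: `ζ(2,2) ≥ 2`, by reflection. [folklore] -/
theorem toy_not_posRootLawAt_2_2_1 : ¬ PosRootLawAt 2 2 1 :=
  not_posRootLawAt_of_certCheck (m := 2) (K := 2) (N := 2) (d := ![0, 1])
    (S := ![![![-1, 0], ![0, -2]], ![![1, 0], ![0, 1]]]) (a := ![1, 3, 4]) (b := ![2, 2, 1])
    (by decide +kernel) (by norm_num)

end Summit.ValiantsHypothesis.ValiantsHypothesis.Theorems.LacunarySymmetroidMatrixDescartes.Census.Reflect
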